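import Summits.MatrixMultiplication.MatrixMultiplication.Theses.FieldSumsetRank

/-!
# FieldSumsetRank / `LowerSandwich` (stmt-MatrixMultiplication-8739)

Route `MatrixMultiplication/FieldSumsetRank`, support item `LowerSandwich`: a polynomial hosting
`(α, β, γ)` of `n × n` matrix multiplication — `ℂ`-linear `α, β : M_n(ℂ) → ℂ[t]`,
`γ : ℂ[t] → M_n(ℂ)` with `γ(α(X)·β(Y)) = XY` — of cost `p = dim (range α · range β)` yields a
bilinear algorithm of length `p`, so `R(⟨n,n,n⟩) ≤ p` (Bürgisser–Clausen–Shokrollahi 1997,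
Prop. (14.47), interpolation half; Bläser 2013 §4).

Proof: `W = range α · range β ⊆ ℂ[t]` is finite-dimensional; the evaluation functionals
`w ↦ w(t)`, `t ∈ ℂ`, span the dual `W*` (a polynomial vanishing at every complex number is zero,
so the coannihilator of their span is `⊥`), hence `p` of them form a basis of `W*`; with the
predual basis `ω_k ∈ W` every `w ∈ W` reads `w = ∑_k w(t_k) ω_k`
(`exists_eval_nodes`). Then `XY = γ(α(X)β(Y)) = ∑_k α(X)(t_k)·β(Y)(t_k)·γ(ω_k)` is a sum of
`p` triads, and `tensorRank_le_card_of_eq_sum` concludes.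
-/

-- the problem-side namespace `Summit.MatrixMultiplication.MatrixMultiplication.Theorems` repeats a
-- segment by design (single-conjunct summit, D-0017), which the `dupNamespace` linter would flag
set_option linter.dupNamespace false

namespace Summit.MatrixMultiplication.MatrixMultiplication.Theorems

open scoped BigOperators Polynomial
open Polynomial Module

/-- **Interpolation nodes.** A finite-dimensional subspace `W ⊆ ℂ[X]` of dimension `p` admits
`p` nodes `t_k ∈ ℂ` and elements `ω_k ∈ W` with `w = ∑_k w(t_k) • ω_k` for every `w ∈ W`
(the evaluations at the nodes form a basis of the dual of `W`, `ω` is the predual basis).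
[folklore] -/
theorem exists_eval_nodes (W : Submodule ℂ ℂ[X]) [FiniteDimensional ℂ W] :
    ∃ (κ : Type) (_ : Fintype κ) (t : κ → ℂ) (ω : κ → W),
      Fintype.card κ = Module.finrank ℂ W ∧
      ∀ w : W, (w : ℂ[X]) = ∑ k, ((w : ℂ[X]).eval (t k)) • (ω k : ℂ[X]) := by
  classical
  -- evaluation functionals restricted to `W`
  let e : ℂ → Module.Dual ℂ W := fun t => (Polynomial.leval t).comp W.subtype
  have he : ∀ t (w : W), e t w = (w : ℂ[X]).eval t := fun t w => rfl
  -- they span the dual space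
  have hspan : Submodule.span ℂ (Set.range e) = ⊤ := by
    have hco : (Submodule.span ℂ (Set.range e)).dualCoannihilator = ⊥ := by
      rw [eq_bot_iff]
      intro w hw
      rw [Submodule.mem_dualCoannihilator] at hw
      rw [Submodule.mem_bot]
      have hzero : ∀ t, (w : ℂ[X]).eval t = 0 := fun t => by
        rw [← he]
        exact hw (e t) (Submodule.subset_span ⟨t, rfl⟩)
      have h0 : (w : ℂ[X]) = 0 := Polynomial.funext (by simpa using hzero)
      exact (Submodule.coe_eq_zero).mp h0
    have h := Subspace.dualCoannihilator_dualAnnihilator_eq (W := Submodule.span ℂ (Set.range e))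
    rw [hco, Submodule.dualAnnihilator_bot] at h
    exact h.symm
  -- extract a linearly independent spanning subfamily: a basis of the dual among evaluations
  obtain ⟨κ, a, -, hsp, hli⟩ := exists_linearIndependent' ℂ e
  rw [hspan] at hsp
  let B : Basis κ ℂ (Module.Dual ℂ W) := Basis.mk hli (by rw [hsp])
  haveI : Finite κ := Module.Finite.finite_basis B
  letI : Fintype κ := Fintype.ofFinite κ
  -- the predual basis
  let ω : κ → W := fun k => (Module.evalEquiv ℂ W).symm (B.dualBasis k)
  refine ⟨κ, inferInstance, a, ω, ?_, ?_⟩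
  · rw [← Subspace.dual_finrank_eq]
    exact (Module.finrank_eq_card_basis B).symm
  · intro w
    have hw : w = ∑ k, (B k w) • ω k := by
      apply (Module.evalEquiv ℂ W).injective
      simp only [map_sum, map_smul, ω, LinearEquiv.apply_symm_apply]
      have h := B.dualBasis.sum_repr (Module.evalEquiv ℂ W w)
      simp only [Basis.dualBasis_repr, Module.evalEquiv_apply, Module.Dual.eval_apply] at h
      exact h.symm
    have hB : ∀ k, B k w = (w : ℂ[X]).eval (a k) := fun k => by
      rw [← he]
      simp [B]
    conv_lhs => rw [hw]
    simp only [Submodule.coe_sum, Submodule.coe_smul, hB]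

/-- **LowerSandwich** (route FieldSumsetRank, stmt-MatrixMultiplication-8739): a polynomial
hosting `(α, β, γ)` of `⟨n,n,n⟩` gives `R(⟨n,n,n⟩) ≤ dim_ℂ (range α · range β)` — evaluate at
`p = dim` interpolation nodes of `W = range α · range β` and read
`XY = γ(α(X)β(Y)) = ∑_k α(X)(t_k) β(Y)(t_k) γ(ω_k)` as `p` triads
(Bürgisser–Clausen–Shokrollahi 1997, Prop. (14.47); Bläser 2013, §4). -/
theorem lowerSandwich_proof :
    Summit.MatrixMultiplication.MatrixMultiplication.Theses.FieldSumsetRank.LowerSandwich := by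
  unfold Summit.MatrixMultiplication.MatrixMultiplication.Theses.FieldSumsetRank.LowerSandwich
  intro n α β γ hγ
  classical
  set W : Submodule ℂ ℂ[X] := LinearMap.range α * LinearMap.range β with hWdef
  haveI : FiniteDimensional ℂ W :=
    Module.Finite.iff_fg.mpr
      ((Module.Finite.iff_fg.mp (inferInstance : Module.Finite ℂ (LinearMap.range α))).mul
        (Module.Finite.iff_fg.mp (inferInstance : Module.Finite ℂ (LinearMap.range β))))
  obtain ⟨κ, _instκ, t, ω, hcard, hrec⟩ := exists_eval_nodes W
  have hmem : ∀ X Y, α X * β Y ∈ W := fun X Y =>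
    Submodule.mul_mem_mul (LinearMap.mem_range_self α X) (LinearMap.mem_range_self β Y)
  -- the hosting read at the nodes
  have key : ∀ X Y : Matrix (Fin n) (Fin n) ℂ,
      X * Y = ∑ k, ((α X).eval (t k) * (β Y).eval (t k)) • γ (ω k : ℂ[X]) := by
    intro X Y
    have h := hrec ⟨α X * β Y, hmem X Y⟩
    simp only [Polynomial.eval_mul] at h
    rw [← hγ X Y, h, map_sum]
    simp only [map_smul]
  rw [← hcard]
  refine Literature.Computability.AlgebraicComplexity.tensorRank_le_card_of_eq_sum
    (fun k (a : Fin n × Fin n) => γ (ω k : ℂ[X]) a.1 a.2)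
    (fun k (b : Fin n × Fin n) => (α (Matrix.single b.1 b.2 1)).eval (t k))
    (fun k (c : Fin n × Fin n) => (β (Matrix.single c.1 c.2 1)).eval (t k)) ?_
  funext a b c
  rw [Finset.sum_apply, Finset.sum_apply, Finset.sum_apply]
  simp only [Literature.Computability.AlgebraicComplexity.triad_apply]
  have hk := key (Matrix.single b.1 b.2 (1 : ℂ)) (Matrix.single c.1 c.2 (1 : ℂ))
  have hk' := congr_fun (congr_fun hk a.1) a.2
  rw [Matrix.sum_apply] at hk'
  simp only [Matrix.smul_apply, smul_eq_mul] at hk'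
  have hprod : (Matrix.single b.1 b.2 (1 : ℂ) * Matrix.single c.1 c.2 (1 : ℂ)) a.1 a.2
      = Literature.Computability.AlgebraicComplexity.matMulTensor ℂ n n n a b c := by
    unfold Literature.Computability.AlgebraicComplexity.matMulTensor
    obtain ⟨a1, a2⟩ := a
    obtain ⟨b1, b2⟩ := b
    obtain ⟨c1, c2⟩ := c
    simp only
    by_cases h : b2 = c1
    · subst h
      rw [Matrix.single_mul_single_same, Matrix.single_apply, mul_one]
      by_cases h1 : a1 = b1 <;> by_cases h2 : a2 = c2 <;> simp [h1, h2, eq_comm]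
    · rw [Matrix.single_mul_single_of_ne (h := h), Matrix.zero_apply]
      simp [h]
  rw [← hprod, hk']
  exact Finset.sum_congr rfl fun k _ => by ring

end Summit.MatrixMultiplication.MatrixMultiplication.Theorems
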